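import Mathlib
import Summits.KontsevichZagierPeriods.Zeta5Search.ClassTypeGuards
import HarnessLib

/-!
# ζ(5) search — CLASS TYPE COVERS III: the record ray's level regions and window wrappers (p3 g6)

HONEST FRAMING: systematic search; no irrationality claim unless certified.  Cell `pub-zeta5`, prover seat p3, generation 6.

For the Brown–Zudilin record ray `b(n) = n·(41; 17,16,15,14,13,12,11)` (`bRec`): the parity flag of `b₀ = 41n`
(`oddFlag_bRec`), the sixteen NET-EXPONENT REGIONS of the ray as level lemmas `ne_low / ne_d1…ne_d6 / ne_well / ne_cen /
ne_u6…ne_u1 / ne_high` (one `omega`-checkable hypothesis each), the typed-class constructors `recType_ne / recType_eq`,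
and the WINDOW WRAPPERS `record_LB / record_J / record_B`: from a class-type cover of the residues (file I/II), the decidable
checks and `41n + 2 < p²`, `5 ≤ p ≤ 25n`, the bound `c ≤ v_p(Cas₇(b(n)))` by THEOREM LB / the Lemma-D bonus / the double-drop
bonus — including the lattice points where the minimal exponent is not attained (fallback `checkLBx`).  The per-window files
`RecordLetters*.lean` (machine-generated) prove only the covers.  Valuations of rationals; every kernel exponent these feed
stays `< 1` — no irrationality content.
-/

open Finset

namespace Summit.KontsevichZagierPeriods.Zeta5Search.ClassTypeCover

open Summit.KontsevichZagierPeriods.Zeta5Search.ClusterValuation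
open Summit.KontsevichZagierPeriods.Zeta5Search.CasoratianValuation (InPolytope shift casoratian)
open Summit.KontsevichZagierPeriods.Zeta5Search.WedgeDictionary (dOf)
open Summit.KontsevichZagierPeriods.Zeta5Search.CellA (dep7 netExp_bRec netExp_bRec_of_ne dep7_lower dep7_upper dep7_low dep7_high
  bRec_zero bRec_zero_toNat)

/-! ## §5 The record ray `b(n) = n·(41; 17,16,15,14,13,12,11)` -/

section Record

variable {n p q x : ℕ}

/-- The parity flag of `b₀ = 41n`. -/
theorem oddFlag_bRec (n : ℕ) {r : ℕ} (hr : n % 2 = r) : decide (¬ (2 : ℤ) ∣ bRec n 0) = decide (r = 1) := by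
  rw [bRec_zero]
  have h2 : (2 : ℤ) ∣ 41 * (n : ℤ) ↔ n % 2 = 0 := by
    constructor
    · intro h; omega
    · intro h; exact ⟨(41 * (n / 2) : ℕ), by push_cast; omega⟩
  by_cases h : n % 2 = 0
  · rw [decide_eq_decide]; constructor
    · intro hn; exact absurd (h2.2 h) hn
    · intro h1; omega
  · rw [decide_eq_decide]; constructor
    · intro _; omega
    · intro _ hd; exact h (h2.1 hd)

/-- Net exponent below the blocks: `q < 11n`. -/
theorem ne_low (h : q < 11 * n) : netExp (bRec n) q = 1 := by
  rw [netExp_bRec_of_ne n q (by omega), dep7_low h]; norm_num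

/-- Net exponent on `[11n, 12n)`. -/
theorem ne_d1 (h : 11 * n ≤ q ∧ q < 12 * n) : netExp (bRec n) q = 0 := by
  rw [netExp_bRec_of_ne n q (by omega), dep7_lower (by norm_num : 1 ≤ 7) (by omega) (by omega)]; norm_num

/-- Net exponent on `[12n, 13n)`. -/
theorem ne_d2 (h : 12 * n ≤ q ∧ q < 13 * n) : netExp (bRec n) q = -1 := by
  rw [netExp_bRec_of_ne n q (by omega), dep7_lower (by norm_num : 2 ≤ 7) (by omega) (by omega)]; norm_num

/-- Net exponent on `[13n, 14n)`. -/
theorem ne_d3 (h : 13 * n ≤ q ∧ q < 14 * n) : netExp (bRec n) q = -2 := by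
  rw [netExp_bRec_of_ne n q (by omega), dep7_lower (by norm_num : 3 ≤ 7) (by omega) (by omega)]; norm_num

/-- Net exponent on `[14n, 15n)`. -/
theorem ne_d4 (h : 14 * n ≤ q ∧ q < 15 * n) : netExp (bRec n) q = -3 := by
  rw [netExp_bRec_of_ne n q (by omega), dep7_lower (by norm_num : 4 ≤ 7) (by omega) (by omega)]; norm_num

/-- Net exponent on `[15n, 16n)`. -/
theorem ne_d5 (h : 15 * n ≤ q ∧ q < 16 * n) : netExp (bRec n) q = -4 := by
  rw [netExp_bRec_of_ne n q (by omega), dep7_lower (by norm_num : 5 ≤ 7) (by omega) (by omega)]; norm_num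

/-- Net exponent on `[16n, 17n)`. -/
theorem ne_d6 (h : 16 * n ≤ q ∧ q < 17 * n) : netExp (bRec n) q = -5 := by
  rw [netExp_bRec_of_ne n q (by omega), dep7_lower (by norm_num : 6 ≤ 7) (by omega) (by omega)]; norm_num

/-- Depth `7` on the whole well `[17n, 24n]`. -/
theorem dep7_well (h1 : 17 * n ≤ q) (h2 : q ≤ 24 * n) : dep7 n q = 7 := by
  unfold dep7; split_ifs <;> omega

/-- Net exponent in the well `[17n, 24n]` off the centre. -/
theorem ne_well (h : 17 * n ≤ q ∧ q ≤ 24 * n ∧ 2 * q ≠ 41 * n) : netExp (bRec n) q = -6 := by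
  rw [netExp_bRec_of_ne n q h.2.2, dep7_well h.1 h.2.1]; norm_num

/-- Net exponent at the (even) centre `2q = 41n`. -/
theorem ne_cen (h : 2 * q = 41 * n) : netExp (bRec n) q = -5 := by
  rw [netExp_bRec, if_pos h, dep7_well (by omega) (by omega)]; norm_num

/-- Net exponent on `(24n, 25n]`. -/
theorem ne_u6 (h : 24 * n < q ∧ q ≤ 25 * n) : netExp (bRec n) q = -5 := by
  rw [netExp_bRec_of_ne n q (by omega), dep7_upper (by norm_num : 6 ≤ 7) (by omega) (by omega)]; norm_num

/-- Net exponent on `(25n, 26n]`. -/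
theorem ne_u5 (h : 25 * n < q ∧ q ≤ 26 * n) : netExp (bRec n) q = -4 := by
  rw [netExp_bRec_of_ne n q (by omega), dep7_upper (by norm_num : 5 ≤ 7) (by omega) (by omega)]; norm_num

/-- Net exponent on `(26n, 27n]`. -/
theorem ne_u4 (h : 26 * n < q ∧ q ≤ 27 * n) : netExp (bRec n) q = -3 := by
  rw [netExp_bRec_of_ne n q (by omega), dep7_upper (by norm_num : 4 ≤ 7) (by omega) (by omega)]; norm_num

/-- Net exponent on `(27n, 28n]`. -/
theorem ne_u3 (h : 27 * n < q ∧ q ≤ 28 * n) : netExp (bRec n) q = -2 := by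
  rw [netExp_bRec_of_ne n q (by omega), dep7_upper (by norm_num : 3 ≤ 7) (by omega) (by omega)]; norm_num

/-- Net exponent on `(28n, 29n]`. -/
theorem ne_u2 (h : 28 * n < q ∧ q ≤ 29 * n) : netExp (bRec n) q = -1 := by
  rw [netExp_bRec_of_ne n q (by omega), dep7_upper (by norm_num : 2 ≤ 7) (by omega) (by omega)]; norm_num

/-- Net exponent on `(29n, 30n]`. -/
theorem ne_u1 (h : 29 * n < q ∧ q ≤ 30 * n) : netExp (bRec n) q = 0 := by
  rw [netExp_bRec_of_ne n q (by omega), dep7_upper (by norm_num : 1 ≤ 7) (by omega) (by omega)]; norm_num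

/-- Net exponent above the blocks: `q > 30n`. -/
theorem ne_high (h : 30 * n < q) : netExp (bRec n) q = 1 := by
  rw [netExp_bRec_of_ne n q (by omega), dep7_high h]; norm_num

variable [Fact p.Prime]

/-- Typed class on the record ray, not self-conjugate. -/
theorem recType_ne (L : ℕ) {T : List ℤ} (hlen : T.length = L + 1) (hx : x < p) (hL : x + L * p ≤ 41 * n)
    (hL' : 41 * n < x + L * p + p) (hlev : Levels (bRec n) x p T) (hne : 2 * x + L * p ≠ 41 * n) :
    IsType (bRec n) p x T false :=
  isType_of_ne (by rw [bRec_zero]; positivity) L hlen hx (by rw [bRec_zero_toNat]; exact hL)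
    (by rw [bRec_zero_toNat]; exact hL') hlev (by rw [bRec_zero_toNat]; exact hne)

/-- Typed class on the record ray, self-conjugate. -/
theorem recType_eq (L : ℕ) {T : List ℤ} (hlen : T.length = L + 1) (hx : x < p) (hL : x + L * p ≤ 41 * n)
    (hL' : 41 * n < x + L * p + p) (hlev : Levels (bRec n) x p T) (heq : 2 * x + L * p = 41 * n) :
    IsType (bRec n) p x T true :=
  isType_of_eq (by rw [bRec_zero]; positivity) L hlen hx (by rw [bRec_zero_toNat]; exact hL)
    (by rw [bRec_zero_toNat]; exact hL') hlev (by rw [bRec_zero_toNat]; exact heq)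

omit [Fact p.Prime] in
/-- The window facts of the record ray. -/
theorem rec_window (hpd : p ≤ 25 * n) (hsq : 41 * n + 2 < p ^ 2) :
    (p : ℤ) ≤ bRec n 0 ∧ (p : ℤ) ≤ dOf (bRec n) ∧ (bRec n 0 + 2 : ℤ) < (p : ℤ) ^ 2 := by
  rw [bRec_zero, dOf_bRec]
  refine ⟨by exact_mod_cast (show p ≤ 41 * n by omega), by exact_mod_cast hpd, by exact_mod_cast hsq⟩

omit [Fact p.Prime] in
/-- THEOREM LB on the record ray. -/
theorem rec_LB (hn : 1 ≤ n) (hpr : p.Prime) (hp5 : 5 ≤ p) (hpd : p ≤ 25 * n) (hsq : 41 * n + 2 < p ^ 2)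
    (hne : casoratian (bRec n) 7 ≠ 0) : casLB (bRec n) p ≤ padicValRat p (casoratian (bRec n) 7) :=
  casoratianClassBound_holds (bRec n) 7 p (inPolytope_bRec n) (by norm_num) (by norm_num)
    (inPolytope_shift_bRec n 7 hn (by norm_num) (by norm_num)) hpr hp5 (rec_window hpd hsq).2.2 hne

omit [Fact p.Prime] in
/-- **RECORD WINDOW BOUND by THEOREM LB**: `c ≤ v_p(Cas₇(b(n)))` from a cover and `checkLB` at `A + B ≥ c` (`c ≤ 0`). -/
theorem record_LB (hn : 1 ≤ n) (hpr : p.Prime) (hp5 : 5 ≤ p) (hpd : p ≤ 25 * n) (hsq : 41 * n + 2 < p ^ 2)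
    {r : ℕ} (hr : n % 2 = r) {TY : List (List ℤ × Bool)} (hcov : Cover (bRec n) p TY) {A B c : ℤ}
    (hLB : checkLB (decide (r = 1)) TY A B = true) (hB1 : B ≤ 1) (hc : c ≤ A + B) (hc0 : c ≤ 0)
    (hne : casoratian (bRec n) 7 ≠ 0) : c ≤ padicValRat p (casoratian (bRec n) 7) := by
  haveI : Fact p.Prime := ⟨hpr⟩
  obtain ⟨-, hpd', -⟩ := rec_window (n := n) hpd hsq
  have hv := rec_LB hn hpr hp5 hpd hsq hne
  rcases casLB_ge_of_cover hcov (by rw [oddFlag_bRec n hr]; exact hLB) hB1 hpd' with h0 | h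
  · rw [h0] at hv; exact le_trans (by exact_mod_cast hc0) hv
  · linarith

omit [Fact p.Prime] in
/-- **RECORD WINDOW BOUND by the LEMMA-D BONUS**: `c ≤ v_p(Cas₇(b(n)))` from a cover, `checkLB` at `(m, B)` with
`c ≤ m + B + 1`, `checkJ` at `m`, and the fallback `checkLBx` at `(m; A', B')` with `c ≤ A' + B'` for the lattice points where
no multipole class attains `m`. -/
theorem record_J (hn : 1 ≤ n) (hpr : p.Prime) (hp5 : 5 ≤ p) (hpd : p ≤ 25 * n) (hsq : 41 * n + 2 < p ^ 2)
    {r : ℕ} (hr : n % 2 = r) {TY : List (List ℤ × Bool)} (hcov : Cover (bRec n) p TY) {m B A' B' c : ℤ}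
    (hLB : checkLB (decide (r = 1)) TY m B = true) (hB1 : B ≤ 1)
    (hJ : checkJ (decide (r = 1)) TY m = true)
    (hLBx : checkLBx (decide (r = 1)) TY m A' B' = true) (hB1' : B' ≤ 1)
    (hc : c ≤ m + B + 1) (hc' : c ≤ A' + B') (hc0 : c ≤ 0)
    (hne : casoratian (bRec n) 7 ≠ 0) : c ≤ padicValRat p (casoratian (bRec n) 7) := by
  haveI : Fact p.Prime := ⟨hpr⟩
  obtain ⟨hpb, hpd', hwin⟩ := rec_window (n := n) hpd hsq
  have hv := rec_LB hn hpr hp5 hpd hsq hne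
  by_cases hreal : ∃ x, x < p ∧ 2 ≤ classPoleCount (bRec n) p x ∧ classExp (bRec n) p x = m
  · have hJ' := lemmaD_of_cover (inPolytope_bRec n) (by norm_num) (by norm_num) (inPolytope_shift_bRec n 7 hn (by norm_num)
      (by norm_num)) hpr hp5 hpb hpd' hwin hcov (by rw [oddFlag_bRec n hr]; exact hJ) hreal hne
    rcases casLB_ge_of_cover hcov (by rw [oddFlag_bRec n hr]; exact hLB) hB1 hpd' with h0 | h
    · rw [h0] at hv; exact le_trans (by exact_mod_cast hc0) hv
    · linarith
  · rcases casLB_ge_of_cover_x hcov (by rw [oddFlag_bRec n hr]; exact hLBx) hB1' hpd' hreal with h0 | h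
    · rw [h0] at hv; exact le_trans (by exact_mod_cast hc0) hv
    · linarith

omit [Fact p.Prime] in
/-- **RECORD WINDOW BOUND by the DOUBLE-DROP BONUS**: `c ≤ v_p(Cas₇(b(n)))` from a cover, `checkLB` at `(−N, B)` with
`c ≤ −N + B + 2`, `checkB` at `N` (`N ≥ 3` even), and the fallback `checkLBx` at `(−N; A', B')` with `c ≤ A' + B'`. -/
theorem record_B (hn : 1 ≤ n) (hpr : p.Prime) (hp5 : 5 ≤ p) (hpd : p ≤ 25 * n) (hsq : 41 * n + 2 < p ^ 2)
    {r : ℕ} (hr : n % 2 = r) {TY : List (List ℤ × Bool)} (hcov : Cover (bRec n) p TY) {N : ℕ} (hN : 3 ≤ N)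
    (hNe : Even N) {B A' B' c : ℤ}
    (hLB : checkLB (decide (r = 1)) TY (-(N : ℤ)) B = true) (hB1 : B ≤ 1)
    (hB : checkB (decide (r = 1)) TY N = true)
    (hLBx : checkLBx (decide (r = 1)) TY (-(N : ℤ)) A' B' = true) (hB1' : B' ≤ 1)
    (hc : c ≤ -(N : ℤ) + B + 2) (hc' : c ≤ A' + B') (hc0 : c ≤ 0)
    (hne : casoratian (bRec n) 7 ≠ 0) : c ≤ padicValRat p (casoratian (bRec n) 7) := by
  haveI : Fact p.Prime := ⟨hpr⟩
  obtain ⟨hpb, hpd', hwin⟩ := rec_window (n := n) hpd hsq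
  have hv := rec_LB hn hpr hp5 hpd hsq hne
  by_cases hreal : ∃ x, x < p ∧ 2 ≤ classPoleCount (bRec n) p x ∧ classExp (bRec n) p x = -(N : ℤ)
  · have hB' := doubleDrop_of_cover (inPolytope_bRec n) (by norm_num) (by norm_num) (inPolytope_shift_bRec n 7 hn (by norm_num)
      (by norm_num)) hpr hp5 hpb hpd' hwin hcov hN hNe (by rw [oddFlag_bRec n hr]; exact hB) hreal hne
    rcases casLB_ge_of_cover hcov (by rw [oddFlag_bRec n hr]; exact hLB) hB1 hpd' with h0 | h
    · rw [h0] at hv; exact le_trans (by exact_mod_cast hc0) hv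
    · linarith
  · rcases casLB_ge_of_cover_x hcov (by rw [oddFlag_bRec n hr]; exact hLBx) hB1' hpd' hreal with h0 | h
    · rw [h0] at hv; exact le_trans (by exact_mod_cast hc0) hv
    · linarith

end Record

end Summit.KontsevichZagierPeriods.Zeta5Search.ClassTypeCover
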